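import Summits.QuantumAdvantage.QuantumAdvantage.Theorems.SosSandwichTransferPBEventOSMDefs
import Literature.Computability.Complexity.ListBricks
import HarnessLib

/-!
# Crux `TransferPB` (stmt-QuantumAdvantage-15238, route SosSandwich), line `birth` — field and code lemmas of the brick programs

For the brick programs of `Theorems/SosSandwichTransferPBEventOSMDefs.lean`: the record builder and the accessors
evaluate as intended on the transition's argument `dArg x (rec8 …) b` and on the action's argument `⟨x, rec8 …⟩`
(`mk8_apply`, `dX_dArg`, `dSt_dArg`, `dBit_dArg`, `dF_zero` … `dF_six`, `dB_dArg`, `kF_zero/one/four/five`, `kB_apply`),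
the one-bit tests (`isC_apply`, `oneBit_isC`, `oneBit_nilT`, `nilT_apply`, `bitT_dArg`), and the list codes
(`encList_append` — coded lists concatenate — `encPathS_append_singleton`, `encOpt_eq_nil_iff`).
All proved; no named fact. Source: S. Arora, B. Barak, Computational Complexity (CUP 2009), §0.1, §1.3.
-/

-- D-0017: single-conjunct summit ⇒ the duplicate `QuantumAdvantage.QuantumAdvantage` is mandated.
set_option linter.dupNamespace false

noncomputable section

namespace Summit.QuantumAdvantage.QuantumAdvantage.Cruxes.TransferPB.Birth

open Finset Literature.Computability.Cryptography Literature.Computability.Complexity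
  Literature.Computability.QuantumComplexity Literature.Computability.QuantumComplexity.ClassicalSimulation
open Brick Plumb

namespace SimTreePB

namespace EvOSM

section Fields

variable (x : List Bool)

/-- `mk8` assembles the record of its field maps. [folklore] -/
@[simp] theorem mk8_apply (f₀ f₁ f₂ f₃ f₄ f₅ f₆ f₇ : List Bool → List Bool) (z : List Bool) :
    mk8 f₀ f₁ f₂ f₃ f₄ f₅ f₆ f₇ z = rec8 (f₀ z) (f₁ z) (f₂ z) (f₃ z) (f₄ z) (f₅ z) (f₆ z) (f₇ z) := by
  simp [mk8, rec8]

/-- `dX ⟨x, ⟨st, [b]⟩⟩ = x`. [folklore] -/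
@[simp] theorem dX_dArg (st : List Bool) (b : Bool) : dX (dArg x st b) = x := by simp [dX, dArg]
/-- `dSt ⟨x, ⟨st, [b]⟩⟩ = st`. [folklore] -/
@[simp] theorem dSt_dArg (st : List Bool) (b : Bool) : dSt (dArg x st b) = st := by simp [dSt, dArg]
/-- `dBit ⟨x, ⟨st, [b]⟩⟩ = [b]`. [folklore] -/
@[simp] theorem dBit_dArg (st : List Bool) (b : Bool) : dBit (dArg x st b) = [b] := by simp [dBit, dArg]

variable (a₀ a₁ a₂ a₃ a₄ a₅ a₆ a₇ : List Bool) (b : Bool)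

/-- Field 0. [folklore] -/
@[simp] theorem dF_zero : dF 0 (dArg x (rec8 a₀ a₁ a₂ a₃ a₄ a₅ a₆ a₇) b) = a₀ := by simp [dF, dArg, rec8]
/-- Field 1. [folklore] -/
@[simp] theorem dF_one : dF 1 (dArg x (rec8 a₀ a₁ a₂ a₃ a₄ a₅ a₆ a₇) b) = a₁ := by simp [dF, dArg, rec8]
/-- Field 2. [folklore] -/
@[simp] theorem dF_two : dF 2 (dArg x (rec8 a₀ a₁ a₂ a₃ a₄ a₅ a₆ a₇) b) = a₂ := by simp [dF, dArg, rec8, nthF]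
/-- Field 3. [folklore] -/
@[simp] theorem dF_three : dF 3 (dArg x (rec8 a₀ a₁ a₂ a₃ a₄ a₅ a₆ a₇) b) = a₃ := by simp [dF, dArg, rec8, nthF]
/-- Field 4. [folklore] -/
@[simp] theorem dF_four : dF 4 (dArg x (rec8 a₀ a₁ a₂ a₃ a₄ a₅ a₆ a₇) b) = a₄ := by simp [dF, dArg, rec8, nthF]
/-- Field 5. [folklore] -/
@[simp] theorem dF_five : dF 5 (dArg x (rec8 a₀ a₁ a₂ a₃ a₄ a₅ a₆ a₇) b) = a₅ := by simp [dF, dArg, rec8, nthF]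
/-- Field 6. [folklore] -/
@[simp] theorem dF_six : dF 6 (dArg x (rec8 a₀ a₁ a₂ a₃ a₄ a₅ a₆ a₇) b) = a₆ := by simp [dF, dArg, rec8, nthF]
/-- Field 7. [folklore] -/
@[simp] theorem dB_dArg : dB (dArg x (rec8 a₀ a₁ a₂ a₃ a₄ a₅ a₆ a₇) b) = a₇ := by simp [dB, dArg, rec8, sndPow]
/-- Field 0 (action argument). [folklore] -/
@[simp] theorem kF_zero : kF 0 (boolPair x (rec8 a₀ a₁ a₂ a₃ a₄ a₅ a₆ a₇)) = a₀ := by simp [kF, rec8]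
/-- Field 1 (action argument). [folklore] -/
@[simp] theorem kF_one : kF 1 (boolPair x (rec8 a₀ a₁ a₂ a₃ a₄ a₅ a₆ a₇)) = a₁ := by simp [kF, rec8]
/-- Field 4 (action argument). [folklore] -/
@[simp] theorem kF_four : kF 4 (boolPair x (rec8 a₀ a₁ a₂ a₃ a₄ a₅ a₆ a₇)) = a₄ := by simp [kF, rec8, nthF]
/-- Field 5 (action argument). [folklore] -/
@[simp] theorem kF_five : kF 5 (boolPair x (rec8 a₀ a₁ a₂ a₃ a₄ a₅ a₆ a₇)) = a₅ := by simp [kF, rec8, nthF]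
/-- Field 7 (action argument). [folklore] -/
@[simp] theorem kB_apply : kB (boolPair x (rec8 a₀ a₁ a₂ a₃ a₄ a₅ a₆ a₇)) = a₇ := by simp [kB, rec8, sndPow]

/-- Value of the test `isC`. [folklore] -/
theorem isC_apply (f : List Bool → List Bool) (c z : List Bool) : isC f c z = [decide (f z = c)] := by
  simp [isC, eqPairFn_boolPair]
/-- `isC` is one-bit. [folklore] -/
theorem oneBit_isC (f : List Bool → List Bool) (c : List Bool) : OneBit (isC f c) := fun z => ⟨_, isC_apply f c z⟩
/-- `nilT` is one-bit. [folklore] -/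
theorem oneBit_nilT (f : List Bool → List Bool) : OneBit (nilT f) := oneBit_isNilFn.comp f
/-- Unfolding the test `nilT`. [folklore] -/
theorem nilT_apply (f : List Bool → List Bool) (z : List Bool) : nilT f z = isNilFn (f z) := rfl
/-- The answer-bit test reads the answer bit. [folklore] -/
@[simp] theorem bitT_dArg (st : List Bool) : bitT (dArg x st b) = [b] := by
  rw [bitT, isC_apply, dBit_dArg]; cases b <;> rfl

end Fields

section Codes

/-- Coded lists concatenate: `encList (l ++ m) = encList l ++ encList m`. [folklore] -/
theorem encList_append : ∀ (l m : List (List Bool)), encList (l ++ m) = encList l ++ encList m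
  | [], m => by simp
  | c :: l, m => by
    rw [List.cons_append, encList_cons, encList_cons, encList_append l m]
    simp [boolPair, List.append_assoc]

/-- Appending an entry to a serialised path appends its frame. [folklore] -/
theorem encPathS_append_singleton : ∀ (π : List (List Bool × Bool)) (u : List Bool) (b : Bool),
    encPathS (π ++ [(u, b)]) = encPathS π ++ boolPair (b :: u) []
  | [], u, b => by simp [encPathS]
  | e :: π, u, b => by
    rw [List.cons_append, encPathS, encPathS, encPathS_append_singleton π u b]
    simp [boolPair, List.append_assoc]

/-- The option code is empty iff there is no candidate. [folklore] -/
@[simp] theorem encOpt_eq_nil_iff (o : Option (List Bool)) : encOpt o = [] ↔ o = none := by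
  cases o <;> simp [encOpt]

end Codes

end EvOSM

end SimTreePB

end Summit.QuantumAdvantage.QuantumAdvantage.Cruxes.TransferPB.Birth

end
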